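import Literature.Analysis.OperatorTheory.YangMillsMatrixModelCutoffEnergy
import HarnessLib

/-!
# The bilinear energy form of Lüscher's `SU(2)` matrix-model Hamiltonian and Green's identity on the `C²_c` core

Topic `Literature/Analysis/OperatorTheory`; a small definitions-and-identities sibling of
`YangMillsMatrixModelDiscreteSpectrum.lean` (the QUADRATIC energy form
`energyForm ψ = ∫ (½ |∇ψ|² + V ψ²)` of `𝔥 = −½Δ + V` on `ℝ⁹`, `V(x) = ¼ Σ_{i,j} |x_i × x_j|²`, its `C²_c` trial
functions `IsTestFn`, the colour-rotation invariant ones `IsGaugeInv`, and the named fact `LuscherSimonGap`)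
and of `YangMillsMatrixModelEigenfunctions.lean` (the pointwise operator `hApply ψ = −½ Δψ + V ψ`).

For the discharge of `LuscherSimonGap` (simplicity of the lowest colour-invariant min–max level) the quadratic
form has to be read as the norm of an INNER PRODUCT on the core (Reed–Simon IV, Thm XIII.2: the min–max levels
of a semibounded form are computed on a form core; Kato VI §1.3: the inner product `(𝔥 + 1)[f, g]` of a closable
form).  This file supplies the polar (bilinear) form and the one identity that ties it to the operator:

* `energyBilin ψ φ = ∫ (½ Σ_p ∂_pψ ∂_pφ + V ψ φ)` — the bilinear energy form; `energyBilin_self :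
  energyBilin ψ ψ = energyForm ψ`, symmetry, additivity and homogeneity in each slot (on differentiable /
  test functions, where the integrals converge);
* ★ `energyBilin_eq_integral_hApply_mul` — **Green's first identity without boundary terms**: for `ψ ∈ C²(ℝ⁹)`
  and a `C²_c` test function `φ`, `energyBilin ψ φ = ∫ (𝔥ψ) φ = ∫ (−½Δψ + Vψ) φ`; and the mirror form
  `energyBilin_eq_integral_mul_hApply` (`ψ` test, `φ ∈ C²`): `energyBilin ψ φ = ∫ ψ (𝔥φ)` — i.e. Kato's
  `𝔥[f, g] = (S f, g)` for the operator `S = 𝔥` on the core (Kato VI §1.3, Example 1.8 / Thm 1.27 format);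
* `coreSubmodule` — the colour-rotation invariant `C²_c` functions as a submodule of `ℝ⁹ → ℝ` (the admissible
  class of `physLevel`, `fun ψ => IsTestFn ψ ∧ IsGaugeInv ψ`, closed under `+` and `•` by the tree's
  `IsTestFn.add/smul`, `IsGaugeInv.add/smul`), with `mem_coreSubmodule_iff`.

Integration by parts is Mathlib's `integral_bilinear_hasLineDerivAt_right_eq_neg_left_of_integrable` along the
coordinate directions `e_p` (no boundary terms: one factor has compact support), exactly as in the tree's
`YangMillsMatrixModelCutoffEnergy.integral_cutoff_ibp`.  No named facts, no instances, no notation.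

## References
* [ReedSimonIV1978] M. Reed, B. Simon, *Methods of Modern Mathematical Physics IV*, Thm XIII.2 (min–max over a
  form core).
* [Kato1966] T. Kato, *Perturbation Theory for Linear Operators*, VI §1.3 (the inner product `(𝔥+1)[u,v]` of a
  sectorial form, Example 1.8; Thm 1.27: the form `(Su, v)` of a symmetric operator bounded below).
-/

noncomputable section

open MeasureTheory Filter Topology
open scoped BigOperators

namespace Literature.Analysis.OperatorTheory.YMMatrixModel

/-! ### 1. The bilinear energy form -/

/-- The **bilinear energy form** of `𝔥 = −½Δ + V` in coordinates,
`𝔮(ψ, φ) = ∫ (½ Σ_p ∂_pψ ∂_pφ + V ψ φ) dx` — the polar form of `energyForm`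
(`energyBilin_self`). [cite: Kato1966, VI §1.3 Example 1.8] -/
def energyBilin (ψ φ : ZM → ℝ) : ℝ :=
  ∫ x, ((1 / 2 : ℝ) * ∑ p, pderiv p ψ x * pderiv p φ x + luscherPotential x * (ψ x * φ x))

/-- `energyBilin` unfolded. [cite: Kato1966, VI §1.3 Example 1.8] -/
theorem energyBilin_def (ψ φ : ZM → ℝ) : energyBilin ψ φ =
    ∫ x, ((1 / 2 : ℝ) * ∑ p, pderiv p ψ x * pderiv p φ x + luscherPotential x * (ψ x * φ x)) := rfl

/-- The bilinear form is symmetric (pointwise symmetric integrand). [cite: Kato1966, VI §1.3 Example 1.8] -/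
theorem energyBilin_comm (ψ φ : ZM → ℝ) : energyBilin ψ φ = energyBilin φ ψ := by
  unfold energyBilin
  congr 1
  funext x
  have h : ∑ p, pderiv p ψ x * pderiv p φ x = ∑ p, pderiv p φ x * pderiv p ψ x :=
    Finset.sum_congr rfl fun p _ => mul_comm _ _
  rw [h, mul_comm (ψ x) (φ x)]

/-- On the diagonal the bilinear form is the quadratic energy form: `𝔮(ψ, ψ) = 𝔮(ψ)`
(`‖∇ψ‖² = Σ_p (∂_pψ)²`). [cite: ReedSimonIV1978, Thm. XIII.2] -/
theorem energyBilin_self (ψ : ZM → ℝ) : energyBilin ψ ψ = energyForm ψ := by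
  unfold energyBilin energyForm
  congr 1
  funext x
  rw [norm_gradient_sq]
  have h : ∑ p, pderiv p ψ x * pderiv p ψ x = ∑ p, pderiv p ψ x ^ 2 :=
    Finset.sum_congr rfl fun p _ => (sq _).symm
  rw [h, sq (ψ x)]

/-- The bilinear form against `0` vanishes. [cite: Kato1966, VI §1.3 Example 1.8] -/
theorem energyBilin_zero_right (ψ : ZM → ℝ) : energyBilin ψ 0 = 0 := by
  unfold energyBilin
  have h : ∀ p x, pderiv p (0 : ZM → ℝ) x = 0 := fun p x => by
    simp [pderiv]
  simp [h]

/-- The bilinear form against `0` vanishes (left slot). [cite: Kato1966, VI §1.3 Example 1.8] -/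
theorem energyBilin_zero_left (φ : ZM → ℝ) : energyBilin 0 φ = 0 := by
  rw [energyBilin_comm, energyBilin_zero_right]

/-! ### 2. Integrability of the integrand; additivity and homogeneity -/

section Integrability

variable {ψ φ ψ₁ ψ₂ : ZM → ℝ}

/-- A continuous function times a compactly supported continuous function is integrable.
[cite: ReedSimonIV1978, Thm. XIII.2] -/
private theorem integrable_mul_of_hasCompactSupport_right {f g : ZM → ℝ} (hf : Continuous f)
    (hg : Continuous g) (hgs : HasCompactSupport g) : Integrable (fun x => f x * g x) :=
  (hf.mul hg).integrable_of_hasCompactSupport hgs.mul_left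

/-- A compactly supported continuous function times a continuous function is integrable.
[cite: ReedSimonIV1978, Thm. XIII.2] -/
private theorem integrable_mul_of_hasCompactSupport_left {f g : ZM → ℝ} (hf : Continuous f)
    (hfs : HasCompactSupport f) (hg : Continuous g) : Integrable (fun x => f x * g x) :=
  (hf.mul hg).integrable_of_hasCompactSupport hfs.mul_right

/-- The kinetic cross term `∂_pψ ∂_pφ` is integrable when `ψ ∈ C²` (indeed `C¹` suffices) and `φ` is a test
function. [cite: ReedSimonIV1978, Thm. XIII.2] -/
theorem integrable_pderiv_mul_pderiv (hψ : ContDiff ℝ 2 ψ) (hφ : IsTestFn φ) (p : Fin 3 × Fin 3) :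
    Integrable fun x => pderiv p ψ x * pderiv p φ x :=
  integrable_mul_of_hasCompactSupport_right (continuous_pderiv_of_contDiff_two hψ p)
    (hφ.continuous_pderiv p) (hφ.hasCompactSupport_pderiv p)

/-- The kinetic part `½ Σ_p ∂_pψ ∂_pφ` of the integrand is integrable (`ψ ∈ C²`, `φ` test).
[cite: ReedSimonIV1978, Thm. XIII.2] -/
theorem integrable_kinetic (hψ : ContDiff ℝ 2 ψ) (hφ : IsTestFn φ) :
    Integrable fun x => (1 / 2 : ℝ) * ∑ p, pderiv p ψ x * pderiv p φ x :=
  (integrable_finsetSum _ fun p _ => integrable_pderiv_mul_pderiv hψ hφ p).const_mul _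

/-- The potential part `V ψ φ` of the integrand is integrable (`ψ` continuous, `φ` test).
[cite: ReedSimonIV1978, Thm. XIII.2] -/
theorem integrable_potential (hψ : Continuous ψ) (hφ : IsTestFn φ) :
    Integrable fun x => luscherPotential x * (ψ x * φ x) :=
  integrable_mul_of_hasCompactSupport_right continuous_luscherPotential (hψ.mul hφ.continuous)
    (hφ.2.mul_left)

/-- The full integrand of `energyBilin ψ φ` is integrable for `ψ ∈ C²`, `φ` a test function.
[cite: ReedSimonIV1978, Thm. XIII.2] -/
theorem integrable_energyBilinIntegrand (hψ : ContDiff ℝ 2 ψ) (hφ : IsTestFn φ) :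
    Integrable fun x =>
      (1 / 2 : ℝ) * ∑ p, pderiv p ψ x * pderiv p φ x + luscherPotential x * (ψ x * φ x) :=
  (integrable_kinetic hψ hφ).add (integrable_potential hψ.continuous hφ)

/-- Partial derivatives are additive on differentiable functions. [cite: ReedSimonIV1978, Thm. XIII.2] -/
theorem pderiv_add (hψ₁ : Differentiable ℝ ψ₁) (hψ₂ : Differentiable ℝ ψ₂) (p : Fin 3 × Fin 3) (x : ZM) :
    pderiv p (ψ₁ + ψ₂) x = pderiv p ψ₁ x + pderiv p ψ₂ x := by
  simp only [pderiv]
  rw [fderiv_add (hψ₁ x) (hψ₂ x)]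
  rfl

/-- Partial derivatives are homogeneous on differentiable functions. [cite: ReedSimonIV1978, Thm. XIII.2] -/
theorem pderiv_smul (hψ : Differentiable ℝ ψ) (c : ℝ) (p : Fin 3 × Fin 3) (x : ZM) :
    pderiv p (c • ψ) x = c * pderiv p ψ x := by
  simp only [pderiv]
  rw [fderiv_const_smul (hψ x) c]
  rfl

/-- **Additivity in the left slot** (test functions against a test function).
[cite: Kato1966, VI §1.3 Example 1.8] -/
theorem energyBilin_add_left (hψ₁ : IsTestFn ψ₁) (hψ₂ : IsTestFn ψ₂) (hφ : IsTestFn φ) :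
    energyBilin (ψ₁ + ψ₂) φ = energyBilin ψ₁ φ + energyBilin ψ₂ φ := by
  unfold energyBilin
  rw [← integral_add (integrable_energyBilinIntegrand hψ₁.1 hφ) (integrable_energyBilinIntegrand hψ₂.1 hφ)]
  congr 1
  funext x
  have h : ∀ p, pderiv p (ψ₁ + ψ₂) x = pderiv p ψ₁ x + pderiv p ψ₂ x :=
    fun p => pderiv_add hψ₁.differentiable hψ₂.differentiable p x
  simp only [h, Pi.add_apply, add_mul, Finset.sum_add_distrib]
  ring

/-- **Additivity in the right slot**. [cite: Kato1966, VI §1.3 Example 1.8] -/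
theorem energyBilin_add_right (hψ : IsTestFn ψ) (hφ₁ : IsTestFn ψ₁) (hφ₂ : IsTestFn ψ₂) :
    energyBilin ψ (ψ₁ + ψ₂) = energyBilin ψ ψ₁ + energyBilin ψ ψ₂ := by
  rw [energyBilin_comm, energyBilin_add_left hφ₁ hφ₂ hψ, energyBilin_comm ψ₁, energyBilin_comm ψ₂]

/-- **Homogeneity in the left slot** (for a differentiable `ψ`). [cite: Kato1966, VI §1.3 Example 1.8] -/
theorem energyBilin_smul_left (hψ : Differentiable ℝ ψ) (c : ℝ) (φ : ZM → ℝ) :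
    energyBilin (c • ψ) φ = c * energyBilin ψ φ := by
  unfold energyBilin
  rw [← integral_const_mul]
  congr 1
  funext x
  have h : ∀ p, pderiv p (c • ψ) x = c * pderiv p ψ x := fun p => pderiv_smul hψ c p x
  have h2 : ∑ p, pderiv p (c • ψ) x * pderiv p φ x = c * ∑ p, pderiv p ψ x * pderiv p φ x := by
    rw [Finset.mul_sum]
    exact Finset.sum_congr rfl fun p _ => by rw [h p, mul_assoc]
  rw [h2]
  simp only [Pi.smul_apply, smul_eq_mul]
  ring

/-- **Homogeneity in the right slot** (for a differentiable `φ`). [cite: Kato1966, VI §1.3 Example 1.8] -/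
theorem energyBilin_smul_right (ψ : ZM → ℝ) (hφ : Differentiable ℝ φ) (c : ℝ) :
    energyBilin ψ (c • φ) = c * energyBilin ψ φ := by
  rw [energyBilin_comm, energyBilin_smul_left hφ, energyBilin_comm]

/-- `energyBilin (−ψ) φ = − energyBilin ψ φ`. [cite: Kato1966, VI §1.3 Example 1.8] -/
theorem energyBilin_neg_left (hψ : Differentiable ℝ ψ) (φ : ZM → ℝ) :
    energyBilin (-ψ) φ = -energyBilin ψ φ := by
  have h := energyBilin_smul_left hψ (-1) φ
  rwa [neg_one_smul, neg_one_mul] at h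

/-- `energyBilin (ψ₁ − ψ₂) φ = energyBilin ψ₁ φ − energyBilin ψ₂ φ` on test functions.
[cite: Kato1966, VI §1.3 Example 1.8] -/
theorem energyBilin_sub_left (hψ₁ : IsTestFn ψ₁) (hψ₂ : IsTestFn ψ₂) (hφ : IsTestFn φ) :
    energyBilin (ψ₁ - ψ₂) φ = energyBilin ψ₁ φ - energyBilin ψ₂ φ := by
  have hneg : IsTestFn (-ψ₂) := by simpa using hψ₂.smul (-1)
  rw [sub_eq_add_neg, energyBilin_add_left hψ₁ hneg hφ, energyBilin_neg_left hψ₂.differentiable,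
    ← sub_eq_add_neg]

/-- The quadratic energy form is nonnegative on the diagonal of the bilinear form.
[cite: ReedSimonIV1978, Thm. XIII.2] -/
theorem energyBilin_self_nonneg (ψ : ZM → ℝ) : 0 ≤ energyBilin ψ ψ := by
  rw [energyBilin_self]; exact energyForm_nonneg ψ

/-- **Polarisation**: `𝔮(ψ + φ) = 𝔮(ψ) + 2𝔮(ψ, φ) + 𝔮(φ)` on test functions.
[cite: Kato1966, VI §1.3 Example 1.8] -/
theorem energyForm_add (hψ : IsTestFn ψ) (hφ : IsTestFn φ) :
    energyForm (ψ + φ) = energyForm ψ + 2 * energyBilin ψ φ + energyForm φ := by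
  rw [← energyBilin_self, energyBilin_add_left hψ hφ (hψ.add hφ), energyBilin_add_right hψ hψ hφ,
    energyBilin_add_right hφ hψ hφ, energyBilin_self, energyBilin_self, energyBilin_comm φ ψ]
  ring

end Integrability

/-! ### 3. Green's identity on the core: `𝔮(ψ, φ) = ∫ (𝔥ψ) φ` -/

section Green

variable {ψ φ : ZM → ℝ}

/-- **One-coordinate integration by parts**: for `ψ ∈ C²(ℝ⁹)` and a `C²_c` test function `φ`,
`∫ ∂_pψ ∂_pφ = −∫ (∂_p∂_pψ) φ` (no boundary term: `φ` has compact support).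
[cite: Kato1966, VI §1.3 Example 1.8] -/
theorem integral_pderiv_mul_pderiv (hψ : ContDiff ℝ 2 ψ) (hφ : IsTestFn φ) (p : Fin 3 × Fin 3) :
    ∫ x, pderiv p ψ x * pderiv p φ x = -∫ x, pderiv p (pderiv p ψ) x * φ x := by
  have hdψd := differentiable_pderiv_of_contDiff_two hψ p
  have hdψc := continuous_pderiv_of_contDiff_two hψ p
  have hddψc := continuous_pderiv_pderiv_of_contDiff_two hψ p p
  have hφc := hφ.continuous
  have hφd := hφ.differentiable
  -- integrability of the three products
  have I1 : Integrable (fun x => pderiv p (pderiv p ψ) x * φ x) :=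
    (hddψc.mul hφc).integrable_of_hasCompactSupport hφ.2.mul_left
  have I2 : Integrable (fun x => pderiv p ψ x * pderiv p φ x) := integrable_pderiv_mul_pderiv hψ hφ p
  have I3 : Integrable (fun x => pderiv p ψ x * φ x) :=
    (hdψc.mul hφc).integrable_of_hasCompactSupport hφ.2.mul_left
  have key := integral_bilinear_hasLineDerivAt_right_eq_neg_left_of_integrable (μ := volume)
    (B := ContinuousLinearMap.mul ℝ ℝ) (f := pderiv p ψ) (f' := pderiv p (pderiv p ψ))
    (g := φ) (g' := pderiv p φ) (v := unitDir p)
    (by simpa only [ContinuousLinearMap.mul_apply'] using I1)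
    (by simpa only [ContinuousLinearMap.mul_apply'] using I2)
    (by simpa only [ContinuousLinearMap.mul_apply'] using I3)
    (fun x _ => hasLineDerivAt_pderiv hdψd x p) (fun x _ => hasLineDerivAt_pderiv hφd x p)
  simpa only [ContinuousLinearMap.mul_apply'] using key

/-- ★ **Green's first identity on the core** (Kato's `𝔥[f, g] = (S f, g)`): for `ψ ∈ C²(ℝ⁹)` and a
`C²_c` test function `φ`, `𝔮(ψ, φ) = ∫ (−½Δψ + Vψ) φ = ∫ (𝔥ψ) φ`.  (Only `φ` needs compact support —
the form used both for core elements `ψ` and, with `ψ` a smooth weak solution, to pass from the weak to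
the classical eigen-equation.) [cite: Kato1966, VI §1.5 Thm. 1.27] -/
theorem energyBilin_eq_integral_hApply_mul (hψ : ContDiff ℝ 2 ψ) (hφ : IsTestFn φ) :
    energyBilin ψ φ = ∫ x, hApply ψ x * φ x := by
  have hφc := hφ.continuous
  have hψc := hψ.continuous
  have hddψc := continuous_pderiv_pderiv_of_contDiff_two hψ
  -- split the integral
  have Ikin := integrable_kinetic hψ hφ
  have Ipot := integrable_potential hψc hφ
  unfold energyBilin
  rw [integral_add Ikin Ipot]
  -- the kinetic term, coordinate by coordinate
  have Idd : ∀ p, Integrable fun x => pderiv p (pderiv p ψ) x * φ x := fun p =>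
    ((hddψc p p).mul hφc).integrable_of_hasCompactSupport hφ.2.mul_left
  have hkin : ∫ x, (1 / 2 : ℝ) * ∑ p, pderiv p ψ x * pderiv p φ x =
      ∫ x, (-(1 / 2 : ℝ) * laplacian ψ x) * φ x := by
    rw [integral_const_mul, integral_finsetSum _ fun p _ => integrable_pderiv_mul_pderiv hψ hφ p]
    have h1 : ∑ p, ∫ x, pderiv p ψ x * pderiv p φ x = ∑ p, -∫ x, pderiv p (pderiv p ψ) x * φ x :=
      Finset.sum_congr rfl fun p _ => integral_pderiv_mul_pderiv hψ hφ p
    have h1' : ∑ p, ∫ x, pderiv p (pderiv p ψ) x * φ x = ∫ x, ∑ p, pderiv p (pderiv p ψ) x * φ x :=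
      (integral_finsetSum _ fun p _ => Idd p).symm
    have h2 : (fun x => (-(1 / 2 : ℝ) * laplacian ψ x) * φ x) =
        fun x => -(1 / 2 : ℝ) * ((∑ p, pderiv p (pderiv p ψ) x * φ x)) := by
      funext x
      rw [laplacian_def, mul_assoc, Finset.sum_mul]
    rw [h1, Finset.sum_neg_distrib, h1', h2, integral_const_mul]
    ring
  have IL : Integrable fun x => (-(1 / 2 : ℝ) * laplacian ψ x) * φ x := by
    have hlc : Continuous (laplacian ψ) := by
      have : laplacian ψ = fun x => ∑ p, pderiv p (pderiv p ψ) x := funext (laplacian_def ψ)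
      rw [this]
      exact continuous_finsetSum _ fun p _ => hddψc p p
    exact ((continuous_const.mul hlc).mul hφc).integrable_of_hasCompactSupport hφ.2.mul_left
  have IV : Integrable fun x => (luscherPotential x * ψ x) * φ x := by
    have := Ipot
    refine this.congr (Eventually.of_forall fun x => ?_)
    simp only; ring
  rw [hkin]
  have h3 : ∫ x, luscherPotential x * (ψ x * φ x) = ∫ x, (luscherPotential x * ψ x) * φ x :=
    integral_congr_ae (Eventually.of_forall fun x => by simp only; ring)
  rw [h3, ← integral_add IL IV]
  congr 1
  funext x
  rw [hApply_def]
  ring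

/-- ★ **Green's identity, mirror form**: for a test function `ψ` and `φ ∈ C²(ℝ⁹)`,
`𝔮(ψ, φ) = ∫ ψ (𝔥φ)`. [cite: Kato1966, VI §1.5 Thm. 1.27] -/
theorem energyBilin_eq_integral_mul_hApply (hψ : IsTestFn ψ) (hφ : ContDiff ℝ 2 φ) :
    energyBilin ψ φ = ∫ x, ψ x * hApply φ x := by
  rw [energyBilin_comm, energyBilin_eq_integral_hApply_mul hφ hψ]
  exact integral_congr_ae (Eventually.of_forall fun x => mul_comm _ _)

/-- **Symmetry of `𝔥` on the core**: `∫ (𝔥ψ) φ = ∫ ψ (𝔥φ)` for test functions `ψ, φ`.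
[cite: Kato1966, VI §1.5 Thm. 1.27] -/
theorem integral_hApply_mul_comm (hψ : IsTestFn ψ) (hφ : IsTestFn φ) :
    ∫ x, hApply ψ x * φ x = ∫ x, ψ x * hApply φ x := by
  rw [← energyBilin_eq_integral_hApply_mul hψ.1 hφ, energyBilin_eq_integral_mul_hApply hψ hφ.1]

/-- **The quadratic form through the operator**: `𝔮(ψ) = ∫ (𝔥ψ) ψ` for a test function `ψ`.
[cite: Kato1966, VI §1.5 Thm. 1.27] -/
theorem energyForm_eq_integral_hApply_mul_self (hψ : IsTestFn ψ) :
    energyForm ψ = ∫ x, hApply ψ x * ψ x := by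
  rw [← energyBilin_self, energyBilin_eq_integral_hApply_mul hψ.1 hψ]

/-- `𝔥ψ` is continuous for `ψ ∈ C²`. [cite: SimonB1983DiscreteSpectrum, eq. (3) p. 211] -/
theorem continuous_hApply (hψ : ContDiff ℝ 2 ψ) : Continuous (hApply ψ) := by
  have hlc : Continuous (laplacian ψ) := by
    have : laplacian ψ = fun x => ∑ p, pderiv p (pderiv p ψ) x := funext (laplacian_def ψ)
    rw [this]
    exact continuous_finsetSum _ fun p _ => continuous_pderiv_pderiv_of_contDiff_two hψ p p
  have : hApply ψ = fun x => -(1 / 2 : ℝ) * laplacian ψ x + luscherPotential x * ψ x :=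
    funext (hApply_def ψ)
  rw [this]
  exact (continuous_const.mul hlc).add (continuous_luscherPotential.mul hψ.continuous)

/-- `𝔥ψ` has compact support for a test function `ψ` (all derivatives vanish off `tsupport ψ`).
[cite: SimonB1983DiscreteSpectrum, eq. (3) p. 211] -/
theorem hasCompactSupport_hApply (hψ : IsTestFn ψ) : HasCompactSupport (hApply ψ) := by
  refine HasCompactSupport.intro hψ.2 fun x hx => ?_
  have h0 : ψ x = 0 := image_eq_zero_of_notMem_tsupport hx
  have h1 : ∀ p, pderiv p (pderiv p ψ) x = 0 := fun p => by
    have hx' : x ∉ tsupport (pderiv p ψ) := fun h =>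
      hx (tsupport_fderiv_apply_subset ℝ (unitDir p) h)
    exact pderiv_eq_zero_of_notMem_tsupport hx' p
  rw [hApply_def, laplacian_def]
  simp [h0, h1]

end Green

/-! ### 4. The colour-invariant `C²_c` core as a submodule -/

/-- The **form core of the physical sector**: colour-rotation invariant `C²_c` functions on `ℝ⁹`, as a real
submodule of `ℝ⁹ → ℝ` — the admissible class `fun ψ => IsTestFn ψ ∧ IsGaugeInv ψ` of `physLevel`.
[cite: ReedSimonIV1978, Thm. XIII.2] -/
def coreSubmodule : Submodule ℝ (ZM → ℝ) where
  carrier := {ψ | IsTestFn ψ ∧ IsGaugeInv ψ}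
  add_mem' := fun hψ hφ => ⟨hψ.1.add hφ.1, hψ.2.add hφ.2⟩
  zero_mem' := ⟨isTestFn_zero, isGaugeInv_zero⟩
  smul_mem' := fun c _ hψ => ⟨hψ.1.smul c, hψ.2.smul c⟩

/-- Membership in the core. [cite: ReedSimonIV1978, Thm. XIII.2] -/
@[simp] theorem mem_coreSubmodule_iff (ψ : ZM → ℝ) :
    ψ ∈ coreSubmodule ↔ IsTestFn ψ ∧ IsGaugeInv ψ := Iff.rfl

/-- The admissible class of `physLevel` is membership in the core. [cite: ReedSimonIV1978, Thm. XIII.2] -/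
theorem physLevel_eq_minmaxLevel_mem_core (k : ℕ) :
    physLevel k = minmaxLevel (fun ψ => ψ ∈ coreSubmodule) k := rfl

/-! ### 5. Green's second identity: `∫ (𝔥ψ) φ = ∫ ψ (𝔥φ)` for `ψ ∈ C²`, `φ ∈ C²_c` (append) -/

section GreenSecond

variable {ψ φ : ZM → ℝ}

/-- **One-coordinate integration by parts, derivatives onto the test function**: for `ψ ∈ C²(ℝ⁹)` (indeed
`C¹` suffices) and a `C²_c` test function `φ`, `∫ ∂_pψ ∂_pφ = −∫ ψ ∂_p∂_pφ` (no boundary term: `φ` has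
compact support). [cite: Kato1966, VI §1.3 Example 1.8] -/
theorem integral_pderiv_mul_pderiv' (hψ : ContDiff ℝ 2 ψ) (hφ : IsTestFn φ) (p : Fin 3 × Fin 3) :
    ∫ x, pderiv p ψ x * pderiv p φ x = -∫ x, ψ x * pderiv p (pderiv p φ) x := by
  have hψd := differentiable_of_contDiff_two hψ
  have hψc : Continuous ψ := hψ.continuous
  have hdψc := continuous_pderiv_of_contDiff_two hψ p
  have hdφc := hφ.continuous_pderiv p
  have hdφd := differentiable_pderiv_of_contDiff_two hφ.1 p
  have hddφc := continuous_pderiv_pderiv_of_contDiff_two hφ.1 p p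
  have hddφs : HasCompactSupport (pderiv p (pderiv p φ)) :=
    (hφ.hasCompactSupport_pderiv p).fderiv_apply (𝕜 := ℝ) (unitDir p)
  -- integrability of the three products
  have I1 : Integrable (fun x => pderiv p ψ x * pderiv p φ x) :=
    (hdψc.mul hdφc).integrable_of_hasCompactSupport (hφ.hasCompactSupport_pderiv p).mul_left
  have I2 : Integrable (fun x => ψ x * pderiv p (pderiv p φ) x) :=
    (hψc.mul hddφc).integrable_of_hasCompactSupport hddφs.mul_left
  have I3 : Integrable (fun x => ψ x * pderiv p φ x) :=
    (hψc.mul hdφc).integrable_of_hasCompactSupport (hφ.hasCompactSupport_pderiv p).mul_left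
  have key := integral_bilinear_hasLineDerivAt_right_eq_neg_left_of_integrable (μ := volume)
    (B := ContinuousLinearMap.mul ℝ ℝ) (f := ψ) (f' := pderiv p ψ)
    (g := pderiv p φ) (g' := pderiv p (pderiv p φ)) (v := unitDir p)
    (by simpa only [ContinuousLinearMap.mul_apply'] using I1)
    (by simpa only [ContinuousLinearMap.mul_apply'] using I2)
    (by simpa only [ContinuousLinearMap.mul_apply'] using I3)
    (fun x _ => hasLineDerivAt_pderiv hψd x p) (fun x _ => hasLineDerivAt_pderiv hdφd x p)
  simp only [ContinuousLinearMap.mul_apply'] at key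
  -- key : ∫ ψ ∂∂φ = −∫ ∂ψ ∂φ
  linarith

/-- **Green's first identity, derivatives onto the test function**: for `ψ ∈ C²(ℝ⁹)` and a `C²_c` test
function `φ`, `𝔮(ψ, φ) = ∫ ψ (𝔥φ) = ∫ ψ (−½Δφ + Vφ)`. [cite: Kato1966, VI §1.5 Thm. 1.27] -/
theorem energyBilin_eq_integral_mul_hApply' (hψ : ContDiff ℝ 2 ψ) (hφ : IsTestFn φ) :
    energyBilin ψ φ = ∫ x, ψ x * hApply φ x := by
  have hφc := hφ.continuous
  have hψc := hψ.continuous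
  have hddφc := continuous_pderiv_pderiv_of_contDiff_two hφ.1
  have hddφs : ∀ p, HasCompactSupport (pderiv p (pderiv p φ)) := fun p =>
    (hφ.hasCompactSupport_pderiv p).fderiv_apply (𝕜 := ℝ) (unitDir p)
  have Ikin := integrable_kinetic hψ hφ
  have Ipot := integrable_potential hψc hφ
  unfold energyBilin
  rw [integral_add Ikin Ipot]
  have Idd : ∀ p, Integrable fun x => ψ x * pderiv p (pderiv p φ) x := fun p =>
    (hψc.mul (hddφc p p)).integrable_of_hasCompactSupport (hddφs p).mul_left
  have hkin : ∫ x, (1 / 2 : ℝ) * ∑ p, pderiv p ψ x * pderiv p φ x =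
      ∫ x, ψ x * (-(1 / 2 : ℝ) * laplacian φ x) := by
    rw [integral_const_mul, integral_finsetSum _ fun p _ => integrable_pderiv_mul_pderiv hψ hφ p]
    have h1 : ∑ p, ∫ x, pderiv p ψ x * pderiv p φ x = ∑ p, -∫ x, ψ x * pderiv p (pderiv p φ) x :=
      Finset.sum_congr rfl fun p _ => integral_pderiv_mul_pderiv' hψ hφ p
    have h1' : ∑ p, ∫ x, ψ x * pderiv p (pderiv p φ) x = ∫ x, ∑ p, ψ x * pderiv p (pderiv p φ) x :=
      (integral_finsetSum _ fun p _ => Idd p).symm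
    have h2 : (fun x => ψ x * (-(1 / 2 : ℝ) * laplacian φ x)) =
        fun x => -(1 / 2 : ℝ) * ((∑ p, ψ x * pderiv p (pderiv p φ) x)) := by
      funext x
      rw [laplacian_def, Finset.mul_sum, Finset.mul_sum, Finset.mul_sum]
      exact Finset.sum_congr rfl fun p _ => by ring
    rw [h1, Finset.sum_neg_distrib, h1', h2, integral_const_mul]
    ring
  have hlc : Continuous (laplacian φ) := by
    have : laplacian φ = fun x => ∑ p, pderiv p (pderiv p φ) x := funext (laplacian_def φ)
    rw [this]
    exact continuous_finsetSum _ fun p _ => hddφc p p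
  have hls : HasCompactSupport (laplacian φ) := by
    refine HasCompactSupport.intro hφ.2 fun x hx => ?_
    rw [laplacian_def]
    refine Finset.sum_eq_zero fun p _ => ?_
    have hx' : x ∉ tsupport (pderiv p φ) := fun h => hx (tsupport_fderiv_apply_subset ℝ (unitDir p) h)
    exact pderiv_eq_zero_of_notMem_tsupport hx' p
  have IL : Integrable fun x => ψ x * (-(1 / 2 : ℝ) * laplacian φ x) :=
    (hψc.mul (continuous_const.mul hlc)).integrable_of_hasCompactSupport (hls.mul_left.mul_left)
  have IV : Integrable fun x => ψ x * (luscherPotential x * φ x) := by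
    refine Ipot.congr (Eventually.of_forall fun x => ?_)
    simp only; ring
  rw [hkin]
  have h3 : ∫ x, luscherPotential x * (ψ x * φ x) = ∫ x, ψ x * (luscherPotential x * φ x) :=
    integral_congr_ae (Eventually.of_forall fun x => by simp only; ring)
  rw [h3, ← integral_add IL IV]
  congr 1
  funext x
  rw [hApply_def]
  ring

/-- ★ **Green's second identity** (symmetry of `𝔥` against ONE compactly supported factor): for
`ψ ∈ C²(ℝ⁹)` and a `C²_c` test function `φ`, `∫ (𝔥ψ) φ = ∫ ψ (𝔥φ)` — the step that turns the distributional
equation `∫ ψ (𝔥φ) = E ∫ ψ φ` of a `C²` function `ψ` into the classical one. [cite: Kato1966, VI §1.5 Thm. 1.27] -/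
theorem integral_hApply_mul_eq_integral_mul_hApply (hψ : ContDiff ℝ 2 ψ) (hφ : IsTestFn φ) :
    ∫ x, hApply ψ x * φ x = ∫ x, ψ x * hApply φ x := by
  rw [← energyBilin_eq_integral_hApply_mul hψ hφ, energyBilin_eq_integral_mul_hApply' hψ hφ]

end GreenSecond

end Literature.Analysis.OperatorTheory.YMMatrixModel

end
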